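import Summits.NavierStokesRegularity.NavierStokesRegularity.Theses.TypeICertificateLadder
import Summits.NavierStokesRegularity.NavierStokesRegularity.Theorems.TypeICertificateLadderTypeIConcentrationDecay
import Summits.NavierStokesRegularity.NavierStokesRegularity.Theorems.TypeICertificateLadderNoTypeIBlowupTypeIMorrey
import Summits.NavierStokesRegularity.NavierStokesRegularity.Theorems.TypeICertificateLadderTypeIConcentrationBP
import HarnessLib

/-!
# Route TypeICertificateLadder — crux `TypeIConcentration` (item stmt-NavierStokesRegularity-2881): PROVED

The crux `TypeIConcentration` (Barker–Prange-type `L³` concentration at a Type-I(`C`) singular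
point of a classical Leray–Hopf rapidly-decaying-datum solution: a point `x₀` with
`γ ν³ ≤ ∫_{B(x₀, ρ√(ν(T−t)))} |u(t)|³` for all `t` near `T`, with `ρ, γ` depending on `C` ONLY),
line `bp-scaled-energy` of `Cruxes/TypeIConcentration/` (the route's printed line):

1. `uniformMorrey_of_rate` — the UNIFORM Morrey bound (Barker–Prange's Type I condition
   (e.typeI) with a constant depending on the rate constant only): `∫_{B(x₁,ρ)}|u(t)|² ≤ Λ(C)ν²ρ`
   for `0 < ρ ≤ r₀(u)` and all late `t`. Proof = the tree's `morrey_of_typeI` (zoom at the fixed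
   scale `R = √(νδ)/2` about every `(T', x₁)`, `zoom_unitCyl_data`, whose Type I constant is
   EXACTLY `C` for the rate `√(T−t)‖u‖ ≤ C√ν` and whose unit-scale data are finite and
   centre-independent) with the affine Lemma 3.5 replaced by its DECAYING form
   `stub_scaledEnergyVertexEventually` (`…TypeIConcentrationDecay.lean`): on scales below
   `r₁(C, data)` the scaled energy `A` is bounded by `d(C)`; transported back by
   `ae_ball_bound_of_energyA_le` and upgraded to every time by continuity
   (`continuousOn_setIntegral_ball_norm_sq`, `forall_le_of_ae_le_of_continuousOn`).
2. `scaledEnergyBound_proof` — support item `ScaledEnergyBound` (stmt-NavierStokesRegularity-2884)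
   VERBATIM (window extracted from `𝓝[<] T`; `HasRapidSpatialDecay` unused).
3. `typeIConcentration_proof` — the crux VERBATIM, by the packaged Barker–Prange 2020 Thm 2
   (`bp_concentration_of_morrey`, PROVED in the tree via `BarkerPrange2020_thm2_holds`) with
   `M := max A 1`.

Unconditional: axioms {propext, Classical.choice, Quot.sound}. (This module imports the route's `Theses`
file — unavoidably so, already through `…NoTypeIBlowupZoom.lean` — and states both items BY NAME; the
`_holds` link is left to the materialiser's skip rule, as for `NoBlowupToClay`.)

References: T. Barker, C. Prange, Arch. Ration. Mech. Anal. 236 (2020) = arXiv:1812.09115, Thm 2,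
(e.typeI) and the remark p. 5 (only `M(M′, u₀, r)` in print); G. Seregin, V. Šverák, Comm. PDE 34
(2009) = arXiv:0804.1803, Lemma 3.5.
-/

noncomputable section

namespace Summit.NavierStokesRegularity.NavierStokesRegularity.Theorems

open MeasureTheory Set Function Filter Topology TopologicalSpace Metric
open Literature.Analysis.FluidPDE Literature.Analysis.FluidPDE.SereginSverak2009
open scoped NNReal ENNReal

/-- **The UNIFORM Morrey bound from the eventual rate** (Barker–Prange's (e.typeI) with a
constant depending on the rate constant `C` only). For every `C` there is `Λ = Λ(C)` such that:
if `(u, p)` is classical on `[0, T)`, Leray–Hopf on `[0, T)` (`ν, T > 0`) and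
`√(T − t)‖u(t, x)‖ ≤ C√ν` on a final window `(T − δ, T)` (`0 < δ ≤ T`), then for some `r₀ > 0`
(depending on the solution) `∫_{B(x₁, ρ)} |u(t)|² ≤ Λ ν² ρ` for all `T − δ/2 < t < T`, all
`x₁` and all `0 < ρ ≤ r₀`. Proof: `morrey_of_typeI` with the decaying Lemma 3.5
(`stub_scaledEnergyVertexEventually`) — zoom scale `R = √(νδ)/2` (zoom Type I constant exactly
`C`), data level `M' = UA + UE + UD < ∞`, `r₁ = r₁(C, M')`, `r₀ = R r₁/4`, `Λ = 2 d(C)`.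
[cite: SereginSverak2009, Lemma 3.5; BarkerPrange2020, (e.typeI) and p. 5] -/
theorem uniformMorrey_of_rate (C : ℝ) :
    ∃ Λ : ℝ, ∀ (ν T : ℝ), 0 < ν → 0 < T →
      ∀ (u : ℝ → EuclideanSpace ℝ (Fin 3) → EuclideanSpace ℝ (Fin 3)) (p : ℝ → EuclideanSpace ℝ (Fin 3) → ℝ),
      IsClassicalNSSolutionOn (Ico 0 T) ν 0 u p → IsLerayHopfOn T ν 0 (u 0) u →
      ∀ δ : ℝ, 0 < δ → δ ≤ T →
      (∀ t ∈ Ioo (T - δ) T, ∀ x, Real.sqrt (T - t) * ‖u t x‖ ≤ C * Real.sqrt ν) →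
      ∃ r₀ : ℝ, 0 < r₀ ∧ ∀ t ∈ Ioo (T - δ / 2) T, ∀ (x₁ : EuclideanSpace ℝ (Fin 3)) (ρ : ℝ),
        0 < ρ → ρ ≤ r₀ → ∫ x in ball x₁ ρ, ‖u t x‖ ^ 2 ≤ Λ * ν ^ 2 * ρ := by
  obtain ⟨d, hd⟩ := stub_scaledEnergyVertexEventually C
  refine ⟨2 * d, ?_⟩
  intro ν T hν hT u p hsol hLH δ hδ hδT hrate
  -- the fixed zoom scale
  set R : ℝ := Real.sqrt (ν * δ) / 2 with hR
  have hRpos : 0 < R := by positivity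
  set α : ℝ := R / ν with hα
  set β : ℝ := R ^ 2 / ν with hβdef
  have hαpos : 0 < α := by positivity
  have hβpos : 0 < β := by positivity
  have hβδ : 4 * β = δ := by
    rw [hβdef, hR, div_pow, Real.sq_sqrt (by positivity)]
    field_simp
    ring
  have hRδ : 4 * (R ^ 2 / ν) ≤ δ := hβδ.le
  -- the zoom's Type I constant is exactly `C`
  have hKC : (R / ν) / Real.sqrt (R ^ 2 / ν) * (C * Real.sqrt ν) = C := by
    have h1 : Real.sqrt (R ^ 2 / ν) = R / Real.sqrt ν := by
      rw [Real.sqrt_div' _ hν.le, Real.sqrt_sq hRpos.le]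
    have h2 : Real.sqrt ν ≠ 0 := (Real.sqrt_pos.2 hν).ne'
    rw [h1]
    field_simp
    rw [Real.sq_sqrt hν.le]
  -- the centre-independent (finite) data level
  set UA : ℝ≥0∞ := (ENNReal.ofReal (3 / 4))⁻¹ * (‖α‖ₑ ^ 2 * (ENNReal.ofReal (R ^ 3)⁻¹ *
    ENNReal.ofReal (2 * VectorCalculus.kineticEnergy (u 0)))) with hUA
  set UE : ℝ≥0∞ := (ENNReal.ofReal (3 / 4))⁻¹ * (ENNReal.ofReal ((α * R) ^ 2) *
    ENNReal.ofReal (β * R ^ 3)⁻¹ *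
      ∫⁻ z in Ioo 0 T ×ˢ (univ : Set (EuclideanSpace ℝ (Fin 3))),
        ENNReal.ofReal (frobeniusNormSq (fderiv ℝ (u z.1) z.2))) with hUE
  set UD : ℝ≥0∞ := ‖(α ^ 2 : ℝ)‖ₑ ^ (3 / 2 : ℝ) * ENNReal.ofReal (β * R ^ 3)⁻¹ *
      ∫⁻ z in Ioo 0 T ×ˢ (univ : Set (EuclideanSpace ℝ (Fin 3))),
        ‖p z.1 z.2 - (p z.1 0 - normalisedPressure (u z.1) 0)‖ₑ ^ (3 / 2 : ℝ) with hUD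
  have h34 : (ENNReal.ofReal (3 / 4 : ℝ))⁻¹ ≠ ⊤ := ENNReal.inv_ne_top.2 (by simp)
  have hUAtop : UA ≠ ⊤ :=
    ENNReal.mul_ne_top h34 (ENNReal.mul_ne_top (ENNReal.pow_ne_top enorm_ne_top)
      (ENNReal.mul_ne_top ENNReal.ofReal_ne_top ENNReal.ofReal_ne_top))
  have hUEtop : UE ≠ ⊤ :=
    ENNReal.mul_ne_top h34 (ENNReal.mul_ne_top (ENNReal.mul_ne_top ENNReal.ofReal_ne_top
      ENNReal.ofReal_ne_top) (SereginSverak2002.lintegral_slab_frobeniusNormSq_fderiv_lt_top' hsol hLH).ne)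
  have hUDtop : UD ≠ ⊤ :=
    ENNReal.mul_ne_top (ENNReal.mul_ne_top (ENNReal.rpow_ne_top_of_nonneg (by norm_num) enorm_ne_top)
      ENNReal.ofReal_ne_top) (SereginSverak2002.lintegral_slab_gauged_pressure_lt_top hν hT hsol hLH).ne
  have hMtop : UA + UE + UD ≠ ⊤ := ENNReal.add_ne_top.2 ⟨ENNReal.add_ne_top.2 ⟨hUAtop, hUEtop⟩, hUDtop⟩
  -- the eventual range of scales for this data level
  obtain ⟨r₁, hr₁0, hr₁4, h35⟩ := hd (UA + UE + UD) hMtop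
  refine ⟨R * r₁ / 4, by positivity, ?_⟩
  intro t ht x₁ ρ hρ hρR
  -- the rescaled radius `r = 2ρ/R < r₁` and the top time `T'`
  set r : ℝ := 2 * ρ / R with hr
  have hr0 : 0 < r := by positivity
  have hrr₁ : r < r₁ := by
    rw [hr, div_lt_iff₀ hRpos]
    nlinarith
  have hr8 : r ≤ 1 / 8 := by
    rw [hr, div_le_iff₀ hRpos]
    nlinarith
  have hρr : ρ ≤ R * r := by rw [hr]; field_simp; linarith
  set T' : ℝ := min T (t + β * r ^ 2 / 2) with hT'
  have hβr : 0 < β * r ^ 2 := by positivity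
  have hT'T : T' ≤ T := min_le_left _ _
  have htT' : t < T' := lt_min ht.2 (by linarith)
  have hT't : T' - β * r ^ 2 < t := by
    have : T' ≤ t + β * r ^ 2 / 2 := min_le_right _ _
    linarith
  have hT'1 : T - δ / 2 < T' := lt_of_lt_of_le (by linarith [ht.1]) htT'.le
  -- the zoom about `(T', x₁)` and the stub
  obtain ⟨hsuit, hL3, hGv, htypeI, hA, hE, hD⟩ :=
    zoom_unitCyl_data hν hT hsol hLH hδT hrate hRpos hRδ hT'1 hT'T x₁
  rw [hKC] at htypeI
  have h35' := h35 _ _ _ hsuit hL3 hGv htypeI (add_le_add (add_le_add hA hE) hD) r ⟨hr0, hrr₁⟩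
  have hAΛ : energyA 0 r (α • stPull β R T' x₁ u) ≤ (d : ℝ≥0∞) :=
    le_trans (le_self_add.trans (le_self_add.trans le_self_add)) h35'
  -- a.e. in time on `(T' − βr², T')`, then at `t` by continuity
  have hae := ae_ball_bound_of_energyA_le hRpos hαpos hβpos x₁ hr0 hAΛ hρr
  have hr1 : r ^ 2 ≤ 1 := by nlinarith
  have hβr1 : β * r ^ 2 ≤ β := by nlinarith
  have hlow : T - δ ≤ T' - β * r ^ 2 := by linarith
  have hlow0 : 0 ≤ T' - β * r ^ 2 := by linarith
  have hX : ENNReal.ofReal (R ^ 3) * ((‖α‖ₑ ^ 2)⁻¹ * (ENNReal.ofReal r * (d : ℝ≥0∞))) =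
      ENNReal.ofReal (2 * d * ν ^ 2 * ρ) := by
    rw [Real.enorm_eq_ofReal hαpos.le, ← ENNReal.ofReal_pow hαpos.le,
      ← ENNReal.ofReal_inv_of_pos (by positivity), ← ENNReal.ofReal_coe_nnreal,
      ← ENNReal.ofReal_mul hr0.le, ← ENNReal.ofReal_mul (inv_nonneg.2 (sq_nonneg α)),
      ← ENNReal.ofReal_mul (by positivity : (0 : ℝ) ≤ R ^ 3)]
    congr 1
    rw [hα, hr]
    field_simp
  have hae' : ∀ᵐ τ ∂(volume.restrict (Ioo (T' - β * r ^ 2) T')),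
      ∫ x in ball x₁ ρ, ‖u τ x‖ ^ 2 ≤ 2 * d * ν ^ 2 * ρ := by
    filter_upwards [hae, ae_restrict_mem measurableSet_Ioo] with τ hτ hτI
    have hτT : τ ∈ Icc 0 T := ⟨by linarith [hτI.1], hτI.2.le.trans hT'T⟩
    have hint : IntegrableOn (fun x => ‖u τ x‖ ^ 2) (ball x₁ ρ) :=
      ((hLH.memLp τ hτT).integrable_norm_pow two_ne_zero).integrableOn
    have e : ∫⁻ x in ball x₁ ρ, ‖u τ x‖ₑ ^ 2 = ENNReal.ofReal (∫ x in ball x₁ ρ, ‖u τ x‖ ^ 2) := by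
      rw [ofReal_integral_eq_lintegral_ofReal hint (Eventually.of_forall fun x => by positivity)]
      refine lintegral_congr fun x => ?_
      rw [← ofReal_norm, ENNReal.ofReal_pow (norm_nonneg _)]
    rw [e, hX] at hτ
    exact (ENNReal.ofReal_le_ofReal_iff (by positivity)).1 hτ
  have hcont := continuousOn_setIntegral_ball_norm_sq hsol hδT hrate x₁ ρ
    (a := T' - β * r ^ 2) (b := T') hlow hT'T
  exact forall_le_of_ae_le_of_continuousOn isOpen_Ioo hcont continuousOn_const hae' t ⟨hT't, htT'⟩

/-- **Support item `ScaledEnergyBound` (stmt-NavierStokesRegularity-2884), the route decl BY NAME**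
(`∀ C > 0, ∃ A, ∀ ν T > 0, ∀ (u, p)` classical on `[0,T)`, Leray–Hopf, rapidly decaying datum,
eventual rate `√(T−t)‖u t x‖ ≤ C√ν` `⇒ ∃ r₀ > 0, ∀ᶠ t ↑ T, ∀ x₀, ∀ 0 < r ≤ r₀,
r⁻¹ ∫_{B(x₀,r)} ‖u t‖² ≤ A ν²`): the uniform Morrey bound `r⁻¹ ∫_{B_r(x₀)} |u(t)|² ≤ A(C) ν²` for `0 < r ≤ r₀` eventually as
`t ↑ T`, for classical Leray–Hopf rapidly-decaying-datum solutions with the eventual rate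
`√(T−t)‖u‖ ≤ C√ν` (`uniformMorrey_of_rate` on the window extracted from the filter `𝓝[<] T`;
`HasRapidSpatialDecay` is not used). [cite: BarkerPrange2020, (e.typeI) and the remark p. 5] -/
theorem scaledEnergyBound_proof :
    Summit.NavierStokesRegularity.NavierStokesRegularity.Theses.TypeICertificateLadder.ScaledEnergyBound := by
  unfold Summit.NavierStokesRegularity.NavierStokesRegularity.Theses.TypeICertificateLadder.ScaledEnergyBound
  intro C hC
  obtain ⟨Λ, hΛ⟩ := uniformMorrey_of_rate C
  refine ⟨Λ, ?_⟩
  intro ν T hν hT u p hsol hLH _hdec hrate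
  -- the rate window `(T − δ, T)`
  obtain ⟨t₁, ht₁T, ht₁⟩ := mem_nhdsLT_iff_exists_Ioo_subset.1 hrate
  set δ : ℝ := min (T - t₁) T with hδ
  have hδpos : 0 < δ := lt_min (sub_pos.2 ht₁T) hT
  have hδT : δ ≤ T := min_le_right _ _
  have hrate' : ∀ t ∈ Ioo (T - δ) T, ∀ x, Real.sqrt (T - t) * ‖u t x‖ ≤ C * Real.sqrt ν := by
    intro t ht x
    have h1 : δ ≤ T - t₁ := min_le_left _ _
    exact ht₁ ⟨by linarith [ht.1], ht.2⟩ x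
  obtain ⟨r₀, hr₀, hmor⟩ := hΛ ν T hν hT u p hsol hLH δ hδpos hδT hrate'
  refine ⟨r₀, hr₀, ?_⟩
  have hev : Ioo (T - δ / 2) T ∈ 𝓝[<] T := Ioo_mem_nhdsLT (by linarith)
  filter_upwards [hev] with t ht x₀ r hr hrr₀
  rw [inv_mul_le_iff₀ hr]
  calc ∫ x in Metric.ball x₀ r, ‖u t x‖ ^ 2 ≤ Λ * ν ^ 2 * r := hmor t ht x₀ r hr hrr₀
    _ = r * (Λ * ν ^ 2) := by ring

/-- **The crux `TypeIConcentration` (item stmt-NavierStokesRegularity-2881), the route decl BY NAME —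
PROVED** (`∀ C > 0, ∃ ρ > 0, ∃ γ > 0, ∀ ν T > 0, ∀ (u, p)` classical on `[0,T)`, Leray–Hopf,
rapidly decaying datum, eventual rate `√(T−t)‖u t x‖ ≤ C√ν`, `¬ HasSmoothExtensionPast ν 0 u T`
`⇒ ∃ x₀, ∀ᶠ t ↑ T, γ ν³ ≤ ∫_{B(x₀, ρ√(ν(T−t)))} ‖u t‖³`).
At a Type-I(`C`) blow-up (eventual rate `√(T−t)‖u(t)‖_∞ ≤ C√ν`, no classical extension past
`T`) of a classical Leray–Hopf rapidly-decaying-datum solution there is a point `x₀` with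
`γ ν³ ≤ ∫_{B(x₀, ρ√(ν(T−t)))} |u(t)|³` for all `t` near `T`, with `ρ = ρ(C)`, `γ` universal.
Proof: `scaledEnergyBound_proof` (uniform Morrey constant `A(C)`) and the packaged Barker–Prange
2020 Thm 2 `bp_concentration_of_morrey` with `M := max A 1` (`A ν² r ≤ M² ν² r`).
[cite: BarkerPrange2020, Thm. 2 (arXiv:1812.09115 pp. 4–5); SereginSverak2009, Lemma 3.5] -/
theorem typeIConcentration_proof :
    Summit.NavierStokesRegularity.NavierStokesRegularity.Theses.TypeICertificateLadder.TypeIConcentration := by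
  unfold Summit.NavierStokesRegularity.NavierStokesRegularity.Theses.TypeICertificateLadder.TypeIConcentration
  obtain ⟨γ, hγ, hBP⟩ := bp_concentration_of_morrey
  intro C hC
  obtain ⟨A, hA⟩ := scaledEnergyBound_proof C hC
  set M : ℝ := max A 1 with hMdef
  have hMpos : 0 < M := lt_of_lt_of_le one_pos (le_max_right _ _)
  have hAM : A ≤ M ^ 2 := by
    have h1 : A ≤ M := le_max_left _ _
    have h2 : (1 : ℝ) ≤ M := le_max_right _ _
    nlinarith
  obtain ⟨ρ, hρ, hBPM⟩ := hBP M hMpos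
  refine ⟨ρ, hρ, γ, hγ, ?_⟩
  intro ν T hν hT u p hcl hLH hdec hrate hnext
  obtain ⟨r₀, hr₀, hmor⟩ := hA ν T hν hT u p hcl hLH hdec hrate
  refine hBPM ν T hν hT u p hcl hLH hdec ⟨r₀, hr₀, ?_⟩ hnext
  filter_upwards [hmor] with t ht y r hr hrr₀
  have h1 := ht y r hr hrr₀
  rw [inv_mul_le_iff₀ hr] at h1
  have hν2 : 0 ≤ ν ^ 2 := sq_nonneg ν
  calc ∫ x in Metric.ball y r, ‖u t x‖ ^ 2 ≤ r * (A * ν ^ 2) := h1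
    _ ≤ r * (M ^ 2 * ν ^ 2) := by
        exact mul_le_mul_of_nonneg_left (mul_le_mul_of_nonneg_right hAM hν2) hr.le
    _ = M ^ 2 * ν ^ 2 * r := by ring

end Summit.NavierStokesRegularity.NavierStokesRegularity.Theorems

end
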